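import Literature.AlgebraicGeometry.Frobenioids.ArchimedeanFSMCounterexample
import Literature.AlgebraicGeometry.Frobenioids.ArchimedeanFSMCounterexampleA
import Literature.AlgebraicGeometry.Frobenioids.ArchimedeanFSMCounterexampleR
import Literature.AlgebraicGeometry.Frobenioids.ArchimedeanFSMProofs
import Literature.AlgebraicGeometry.Frobenioids.ArchimedeanFSMMonoCondBR
import Literature.AlgebraicGeometry.Frobenioids.ArchimedeanFSMRepaired
import Literature.AlgebraicGeometry.Frobenioids.ArchimedeanFSMRegime
import Literature.AlgebraicGeometry.Frobenioids.ArchimedeanBaseRC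
import Literature.AlgebraicGeometry.Frobenioids.ElementaryPreFrobenioid
import Mathlib.CategoryTheory.ComposableArrows.Basic
import HarnessLib

/-!
# Frobenioids II, Proposition 3.4 (i)/(ii)/(iii): the per-tower predicates are NOT tautologies of a tower
# (abc-iut cell, layer L1, node `FrdII:Prop3.4(i)–(iii)`; FACT-LIST rows F-0815 `Tower.PropI`,
# F-0816 `Tower.PropII`, F-0817 `Tower.PropIII` — universal closures, and the instance forms by name)

Mochizuki, *The geometry of Frobenioids II: poly-Frobenioids*, Kyushu J. Math. **62** (2008)
401–460, §3, Proposition 3.4 (i) p. 29, (ii)–(iii) p. 30 [cite: MochizukiFrdII2008, Prop 3.4 (i) p.29].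

PROOF-ONLY file (nothing is defined). The cell states each item of Prop. 3.4 once as a predicate of an
ABSTRACT tower `T : ArchFrd.Tower π` (`ArchimedeanFSM.lean`: arbitrary categories `F`, `F₀`, arbitrary
projection functors `F → D`, `F → F₀ → D₀`, arbitrary pre-Frobenioid structures) and the printed item
as the conjunction over the three NAMED towers `towerA π`, `towerN π`, `towerR π` (`F ∈ {A, N, R}`,
p. 29: "let `F` be one of the following categories: `A`, `N`, `R`"). The FACT-LIST rows F-0815 / F-0816 /
F-0817 carry the bare predicates `Tower.PropI`, `Tower.PropII`, `Tower.PropIII`; their universal closures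
quantify over EVERY tower and are recorded here as FALSE (so that no seat tries to prove them), by
two-object "towers" `F = Fin 2` over a constant base `Spec ℝ` (zero divisor monoids, zero sections as
pre-Frobenioid structures — the same device as `ArchimedeanFSMTowerSchema.lean` for rows F-0819/23/24):
* `Tower.not_forall_propI`: `Fin 2 → D`, `D` the preorder of NONEMPTY subsets of a two-point set,
  `0 ↦ {ff}`, `1 ↦ {ff, tt}`; the arrow `0 → 1` of `Fin 2` is fiberwise-surjective, its image
  `{ff} ⊆ {ff, tt}` is not (the arrow `{tt} ⊆ {ff, tt}` admits no common refinement with it);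
* `Tower.not_forall_propII`: `Fin 2 → D₀`, `0 ↦ Spec ℂ`, `1 ↦ Spec ℝ`, `(0 → 1) ↦ (Spec ℂ → Spec ℝ)`,
  base `D₀ → D₀` CONSTANT at `Spec ℝ`; the arrow `0 → 1` is a monomorphism satisfying condition (a)
  (it projects to `id_{Spec ℝ}` of `D₀`), its image `Spec ℂ → Spec ℝ` is not a monomorphism of `D = D₀`
  (`ArchFrd.D0.not_mono_toRealHom`);
* `Tower.not_forall_propIII`: here no junk tower is needed — the NAMED tower `N` over `D := D₀`,
  `π := 𝟭`, is the cell's counterexample `ArchFrd.towerN_id_not_propIII` (`ArchimedeanFSMCounterexample.lean`).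
What print asserts — the items for `F ∈ {A, N, R}` — is recorded next to them BY NAME (instance forms):
(i) PROVED over every base (`A.propI`, `N.propI`, `R.propI` = the conjuncts of `prop34_i_holds`);
(ii) PROVED over every base (`A.propII`, `N.propII`, `R.propII`, `prop34_ii_holds`, files
`ArchimedeanFSMMonoCondB{A,N,R}.lean`); (iii) REFUTED as typed at each named tower over `D₀`
(`towerA_id_not_propIII`, `towerN_id_not_propIII`, `towerR_id_not_propIII`) and PROVED in the complex
regime (`A.propIII_of_isComplexRegime` etc., from `prop34_iii_of_isComplex`; repaired row `Prop34_iiiR`,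
`prop34_iiiR_holds`) and over bases all of whose arrows are invertible (`Tower.propIII_of_isIso_hom`).
Typed ≠ print; refuted-as-schema ≠ refuted-in-print; no side is taken on [IUTchIII] Cor. 3.12.

APPENDED (same seat, rows F-0818 `Tower.PropIV`, F-0820 `Tower.PropVI`, F-0821 `Tower.PropVII`): the
universal closures of the per-tower forms of items (iv), (vi) (main clause) and (vii) are false as well
(`Tower.not_forall_propIV` over the complexifiable base `𝟭 D₀`; `Tower.not_forall_propVI` by the
`Fin 2 → Fin 3` skip tower; `Tower.not_forall_propVII` by the nonempty-subsets tower with constant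
`F → F₀`), while the instance forms at the named towers hold over every base (`prop34_iv_holds`,
`prop34_vi_main`, `prop34_vii_holds`). With `ArchimedeanFSMTowerSchema.lean` (rows F-0819/23/24) every
per-tower predicate `Tower.PropI` … `Tower.PropVIII` of `ArchimedeanFSM.lean` now has its universal
closure refuted in the tree (`towerN_id_not_propVIII` for (viii)).
-/

namespace Literature.AlgebraicGeometry.Frobenioids

open CategoryTheory

noncomputable section

namespace ArchFrd

/-! ### Arrows of the small categories used as junk towers -/

/-- Every arrow `0 → a` of the preorder category `Fin 2` is fiberwise-surjective (`0` is a least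
element, so `(id, 0 → X)` refines any pair of arrows into `a`). [cite: MochizukiFrdI2008, §0 p.14] -/
private theorem isFiberwiseSurjective_fin2 (f : (0 : Fin 2) ⟶ 1) : IsFiberwiseSurjective f :=
  fun X _ => ⟨0, 𝟙 _, homOfLE (Fin.zero_le X), Subsingleton.elim _ _⟩

/-- Every arrow of a preorder category is a monomorphism. [cite: MochizukiFrdI2008, §0 p.14] -/
private theorem mono_fin2 (f : (0 : Fin 2) ⟶ 1) : Mono f := ⟨fun _ _ _ => Subsingleton.elim _ _⟩

/-- The monotone map `Fin 2 →` (nonempty subsets of `{ff, tt}`), `0 ↦ {ff}`, `1 ↦ {ff, tt}`.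
[cite: MochizukiFrdII2008, Prop 3.4 (i) p.29] -/
private theorem monotone_sets :
    Monotone (fun i : Fin 2 =>
      if i = 0 then (⟨{false}, Finset.singleton_nonempty _⟩ : {s : Finset Bool // s.Nonempty})
      else ⟨Finset.univ, Finset.univ_nonempty⟩) := by
  intro i j hij
  fin_cases i <;> fin_cases j
  · exact le_rfl
  · exact Finset.subset_univ _
  · exact absurd hij (by decide)
  · exact le_rfl

/-- In the preorder of nonempty subsets of `{ff, tt}`, the arrow `{ff} ⊆ {ff, tt}` is NOT
fiberwise-surjective: a common refinement with `{tt} ⊆ {ff, tt}` would be a nonempty subset of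
`{ff} ∩ {tt} = ∅`. [cite: MochizukiFrdI2008, §0 p.14] -/
private theorem not_isFiberwiseSurjective_sets
    (g : (⟨{false}, Finset.singleton_nonempty _⟩ : {s : Finset Bool // s.Nonempty}) ⟶
      ⟨Finset.univ, Finset.univ_nonempty⟩) : ¬ IsFiberwiseSurjective g := by
  intro h
  obtain ⟨R, δB, δX, -⟩ :=
    @h ⟨{true}, Finset.singleton_nonempty _⟩ (homOfLE (Finset.subset_univ _))
  obtain ⟨x, hx⟩ := R.2
  have h1 : x ∈ ({false} : Finset Bool) := leOfHom δB hx
  have h2 : x ∈ ({true} : Finset Bool) := leOfHom δX hx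
  rw [Finset.mem_singleton] at h1 h2
  exact Bool.false_ne_true (h1.symm.trans h2)

/-! ### The universal closures of the per-tower predicates (i), (ii), (iii) are false -/

/-- **`Tower.PropI` is not a property of every tower** (universal closure of FACT-LIST row F-0815
REFUTED at object universe `0`): the tower `Fin 2 → D`, `D` = nonempty subsets of `{ff, tt}`,
`0 ↦ {ff}`, `1 ↦ {ff, tt}`, over the constant base `Spec ℝ`, has the fiberwise-surjective arrow `0 → 1`
projecting to `{ff} ⊆ {ff, tt}`, which is not fiberwise-surjective. The instance forms at the named
towers `A, N, R` hold over every base (`A.propI`, `N.propI`, `R.propI`, `prop34_i_holds`).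
[cite: MochizukiFrdII2008, Prop 3.4 (i) p.29] -/
theorem Tower.not_forall_propI :
    ¬ ∀ (D : Type) [Category.{0} D] (π : D ⥤ D0) (T : Tower π), T.PropI := by
  intro h
  let π : {s : Finset Bool // s.Nonempty} ⥤ D0 := (Functor.const _).obj D0.real
  let G : Fin 2 ⥤ {s : Finset Bool // s.Nonempty} := monotone_sets.functor
  let T : Tower π :=
    { F := Fin 2, F0 := Fin 2, toD := G, toF0 := 𝟭 _, base0 := (Functor.const _).obj D0.real,
      monoid := (zeroMonoid {s : Finset Bool // s.Nonempty} :
        {s : Finset Bool // s.Nonempty}ᵒᵖ ⥤ CommMonCat.{0}),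
      str := G ⋙ ElemFrobenioid.zeroSection _,
      monoid0 := (zeroMonoid D0 : D0ᵒᵖ ⥤ CommMonCat.{0}),
      str0 := (Functor.const (Fin 2)).obj D0.real ⋙ ElemFrobenioid.zeroSection _,
      region := fun _ => AngularRegion.isotropicOfTip 1 }
  let f : (0 : Fin 2) ⟶ 1 := homOfLE (by decide)
  exact not_isFiberwiseSurjective_sets (G.map f) (h _ π T f (isFiberwiseSurjective_fin2 f))

/-- **`Tower.PropII` is not a property of every tower** (universal closure of FACT-LIST row F-0816
REFUTED at object universe `0`): the tower `Fin 2 → D₀`, `(0 → 1) ↦ (Spec ℂ → Spec ℝ)`, over the base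
`D₀ → D₀` CONSTANT at `Spec ℝ`: the arrow `0 → 1` is a monomorphism of `Fin 2` satisfying condition (a)
(it projects to the identity of `Spec ℝ` in `D₀`), but its image `Spec ℂ → Spec ℝ` is not a monomorphism
of `D = D₀` (`D0.not_mono_toRealHom`). The instance forms at the named towers `A, N, R` hold over every
base (`A.propII`, `N.propII`, `R.propII`, `prop34_ii_holds`). [cite: MochizukiFrdII2008, Prop 3.4 (ii) p.30] -/
theorem Tower.not_forall_propII :
    ¬ ∀ (D : Type) [Category.{0} D] (π : D ⥤ D0) (T : Tower π), T.PropII := by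
  intro h
  let π : D0 ⥤ D0 := (Functor.const _).obj D0.real
  let G : Fin 2 ⥤ D0 := ComposableArrows.mk₁ D0.toRealHom
  let T : Tower π :=
    { F := Fin 2, F0 := Fin 2, toD := G, toF0 := 𝟭 _, base0 := (Functor.const _).obj D0.real,
      monoid := (zeroMonoid D0 : D0ᵒᵖ ⥤ CommMonCat.{0}),
      str := G ⋙ ElemFrobenioid.zeroSection _,
      monoid0 := (zeroMonoid D0 : D0ᵒᵖ ⥤ CommMonCat.{0}),
      str0 := (Functor.const (Fin 2)).obj D0.real ⋙ ElemFrobenioid.zeroSection _,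
      region := fun _ => AngularRegion.isotropicOfTip 1 }
  let f : (0 : Fin 2) ⟶ 1 := homOfLE (by decide)
  have hA : T.CondA f := by
    change IsIso (π.map (G.map f))
    change IsIso (𝟙 D0.real)
    infer_instance
  have hm : Mono (G.map f) := h D0 π T f (mono_fin2 f) (Or.inl hA)
  have hGf : G.map f = D0.toRealHom := D0.hom_complex_real_eq _
  rw [hGf] at hm
  exact D0.not_mono_toRealHom hm

/-- **`Tower.PropIII` is not a property of every tower** (universal closure of FACT-LIST row F-0817
REFUTED at object universe `0`) — and here the witness is a NAMED tower: `N` over `D := D₀`, `π := 𝟭`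
(`towerN_id_not_propIII`: the half-circle arrow is an FSM-morphism of `N` whose image `Spec ℂ → Spec ℝ`
is not a monomorphism of `D₀`). [cite: MochizukiFrdII2008, Prop 3.4 (iii) p.30] -/
theorem Tower.not_forall_propIII :
    ¬ ∀ (D : Type) [Category.{0} D] (π : D ⥤ D0) (T : Tower π), T.PropIII :=
  fun h => towerN_id_not_propIII (h D0 (𝟭 D0) (towerN (𝟭 D0)))

/-! ### The instance forms at the named towers `A`, `N`, `R`, by name -/

universe v u

variable {D : Type u} [Category.{v} D] (π : D ⥤ D0)

/-- **Prop. 3.4 (i) for `F = A`**, every base: fiberwise-surjective morphisms of `A` project to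
fiberwise-surjective morphisms of `D` (conjunct of `prop34_i_holds`). [cite: MochizukiFrdII2008, Prop 3.4 (i) p.29] -/
theorem A.propI : (towerA π).PropI := (prop34_i_holds π).1

/-- **Prop. 3.4 (i) for `F = N`**, every base (conjunct of `prop34_i_holds`). [cite: MochizukiFrdII2008, Prop 3.4 (i) p.29] -/
theorem N.propI : (towerN π).PropI := (prop34_i_holds π).2.1

/-- **Prop. 3.4 (i) for `F = R`**, every base (conjunct of `prop34_i_holds`). [cite: MochizukiFrdII2008, Prop 3.4 (i) p.29] -/
theorem R.propI : (towerR π).PropI := (prop34_i_holds π).2.2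

/-- **Prop. 3.4 (ii) for `F = A, N, R`**, every base, by name (`A.propII`, `N.propII`, `R.propII` of
`ArchimedeanFSMMonoCondB{A,N,R}.lean`). [cite: MochizukiFrdII2008, Prop 3.4 (ii) p.30] -/
theorem Tower.propII_named : (towerA π).PropII ∧ (towerN π).PropII ∧ (towerR π).PropII :=
  ⟨A.propII π, N.propII π, R.propII π⟩

/-- **Prop. 3.4 (iii) for `F = A` in the complex regime** (every object of `D` over `Spec ℂ`; conjunct of
`prop34_iii_of_isComplex`). [cite: MochizukiFrdII2008, Prop 3.4 (iii) p.30] -/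
theorem A.propIII_of_isComplexRegime (hD : IsComplexRegime π) : (towerA π).PropIII :=
  (prop34_iii_of_isComplex π hD).1

/-- **Prop. 3.4 (iii) for `F = N` in the complex regime** (conjunct of `prop34_iii_of_isComplex`).
[cite: MochizukiFrdII2008, Prop 3.4 (iii) p.30] -/
theorem N.propIII_of_isComplexRegime (hD : IsComplexRegime π) : (towerN π).PropIII :=
  (prop34_iii_of_isComplex π hD).2.1

/-- **Prop. 3.4 (iii) for `F = R` in the complex regime** (conjunct of `prop34_iii_of_isComplex`).
[cite: MochizukiFrdII2008, Prop 3.4 (iii) p.30] -/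
theorem R.propIII_of_isComplexRegime (hD : IsComplexRegime π) : (towerR π).PropIII :=
  (prop34_iii_of_isComplex π hD).2.2

/-- **Prop. 3.4 (iii) as typed fails at EACH named tower over `D := D₀`, `π := 𝟭`**, by name
(`towerA_id_not_propIII`, `towerN_id_not_propIII`, `towerR_id_not_propIII`): the instance forms of row
F-0817 at the printed towers are themselves base-dependent (refuted over `D₀`, proved in the complex
regime). [cite: MochizukiFrdII2008, Prop 3.4 (iii) p.30] -/
theorem Tower.propIII_named_id_false :
    ¬ (towerA (𝟭 D0)).PropIII ∧ ¬ (towerN (𝟭 D0)).PropIII ∧ ¬ (towerR (𝟭 D0)).PropIII :=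
  ⟨towerA_id_not_propIII, towerN_id_not_propIII, towerR_id_not_propIII⟩

/-! ### Items (iv), (vi) (main clause), (vii): the universal closures are false as well
(FACT-LIST rows F-0818 `Tower.PropIV`, F-0820 `Tower.PropVI`, F-0821 `Tower.PropVII`, appended by the
same seat; instance forms at the named towers: `prop34_iv_holds` = `A.propIV ∧ N.propIV ∧ R.propIV`
(`ArchimedeanFSMOverIsoProofs.lean`), `prop34_vi_main` = `A.propVI ∧ N.propVI ∧ R.propVI`
(`ArchimedeanFSMLifting.lean`), `prop34_vii_holds` = `A.propVII ∧ N.propVII ∧ R.propVII`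
(`ArchimedeanFSMPullbackFSMI.lean`) — all three over EVERY base, hypothesis-free) -/

section MoreSchemata

/-- Every arrow of the preorder category `Fin 2` is an FSM-morphism (roofs through the least element
`0`; all arrows of a preorder are monic). [cite: MochizukiFrdI2008, §0 p.14] -/
private theorem isFSM_fin2 {a b : Fin 2} (g : a ⟶ b) : IsFSM g :=
  ⟨fun X _ => ⟨0, homOfLE (Fin.zero_le a), homOfLE (Fin.zero_le X), Subsingleton.elim _ _⟩,
    ⟨fun _ _ _ => Subsingleton.elim _ _⟩⟩

/-- The monotone map `Fin 2 → Fin 3`, `0 ↦ 0`, `1 ↦ 2` (the device of `ArchimedeanFSMTowerSchema.lean`).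
[cite: MochizukiFrdII2008, Prop 3.4 (vi) p.30] -/
private theorem monotone_skip' : Monotone (fun i : Fin 2 => if i = 0 then (0 : Fin 3) else 2) := by
  unfold Monotone
  decide

/-- The monotone map (nonempty subsets of `{ff, tt}`) `→ Fin 2`, `s ↦ 1` if `tt ∈ s`, else `0`.
[cite: MochizukiFrdII2008, Prop 3.4 (vii) p.30] -/
private theorem monotone_memTrue :
    Monotone (fun s : {s : Finset Bool // s.Nonempty} => if true ∈ s.1 then (1 : Fin 2) else 0) := by
  intro s t hst
  by_cases hs : true ∈ s.1
  · have ht : true ∈ t.1 := hst hs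
    simp only [hs, ht, if_true, le_refl]
  · simp only [hs, if_false]
    exact Fin.zero_le _

/-- Identities are pull-back morphisms of any pre-Frobenioid ([FrdI] Def. 1.2 (ii): the natural map
`γ ↦ (γ ≫ id, Base γ)` is bijective). [cite: MochizukiFrdI2008, Def. 1.2(ii)] -/
private theorem isPullbackMorphism_id {C' : Type*} [Category C'] {B : Type*} [Category B]
    {Φ : Bᵒᵖ ⥤ CommMonCat} (F : C' ⥤ ElemFrobenioid Φ) (A : C') :
    PreFrobenioid.IsPullbackMorphism F (𝟙 A) := by
  intro X
  constructor
  · intro γ γ' h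
    have h1 := congrArg (fun p : PreFrobenioid.PullbackHomData F (𝟙 A) X => p.1.1) h
    change γ ≫ 𝟙 A = γ' ≫ 𝟙 A at h1
    simpa using h1
  · rintro ⟨⟨p1, p2⟩, hp⟩
    refine ⟨p1, Subtype.ext (Prod.ext (Category.comp_id _) ?_)⟩
    change PreFrobenioid.Base F p1 = p2
    rw [hp, PreFrobenioid.base_id, Category.comp_id]

/-- **`Tower.PropIV` is not a property of every tower** (universal closure of FACT-LIST row F-0818
REFUTED at object universe `0`): over the COMPLEXIFIABLE base `D := D₀`, `π := 𝟭`
(`D0.rc_isComplexifiable_id_comp`), the tower `F = Fin 2 → D₀` CONSTANT at `Spec ℂ` with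
`F → F₀ =` (nonempty subsets of `{ff, tt}`), `0 ↦ {ff}`, `1 ↦ {ff, tt}`: the FSM-morphism `0 → 1`
projects to the identity of `Spec ℂ` (an isomorphism of `D`) but to `{ff} ⊆ {ff, tt}` in `F₀`, which is
not fiberwise-surjective, hence not an FSM-morphism. The instance forms at the named towers `A, N, R`
hold over every base (`A.propIV`, `N.propIV`, `R.propIV`, `prop34_iv_holds`).
[cite: MochizukiFrdII2008, Prop 3.4 (iv) p.30] -/
theorem Tower.not_forall_propIV :
    ¬ ∀ (D : Type) [Category.{0} D] (π : D ⥤ D0) (T : Tower π), T.PropIV := by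
  intro h
  let G : Fin 2 ⥤ {s : Finset Bool // s.Nonempty} := monotone_sets.functor
  let T : Tower (𝟭 D0) :=
    { F := Fin 2, F0 := {s : Finset Bool // s.Nonempty},
      toD := (Functor.const (Fin 2)).obj D0.complex, toF0 := G,
      base0 := (Functor.const _).obj D0.real,
      monoid := (zeroMonoid D0 : D0ᵒᵖ ⥤ CommMonCat.{0}),
      str := (Functor.const (Fin 2)).obj D0.complex ⋙ ElemFrobenioid.zeroSection _,
      monoid0 := (zeroMonoid D0 : D0ᵒᵖ ⥤ CommMonCat.{0}),
      str0 := (Functor.const {s : Finset Bool // s.Nonempty}).obj D0.real ⋙ ElemFrobenioid.zeroSection _,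
      region := fun _ => AngularRegion.isotropicOfTip 1 }
  let f : (0 : Fin 2) ⟶ 1 := homOfLE (by decide)
  have hiso : IsIso (T.toD.map f) := by
    change IsIso (𝟙 D0.complex)
    infer_instance
  exact not_isFiberwiseSurjective_sets (G.map f)
    ((h D0 (𝟭 D0) T D0.rc_isComplexifiable_id_comp f hiso).1 (isFSM_fin2 f)).1

/-- **`Tower.PropVI` (the main lifting clause) is not a property of every tower** (universal closure of
FACT-LIST row F-0820 REFUTED at object universe `0`): in the tower `Fin 2 → Fin 3`, `0 ↦ 0, 1 ↦ 2`, over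
the constant base `Spec ℝ`, the projection `0 → 2` of the arrow `0 → 1` factors through `1 ∈ Fin 3`,
but no object of `Fin 2` projects to an object isomorphic to `1` — so the factorization does not lift.
The instance forms at the named towers `A, N, R` hold over every base (`A.propVI`, `N.propVI`,
`R.propVI`, `prop34_vi_main`). [cite: MochizukiFrdII2008, Prop 3.4 (vi) p.30] -/
theorem Tower.not_forall_propVI :
    ¬ ∀ (D : Type) [Category.{0} D] (π : D ⥤ D0) (T : Tower π), T.PropVI := by
  intro h
  let πb : Fin 3 ⥤ D0 := (Functor.const _).obj D0.real
  let G : Fin 2 ⥤ Fin 3 := monotone_skip'.functor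
  let T : Tower πb :=
    { F := Fin 2, F0 := Fin 2, toD := G, toF0 := 𝟭 _, base0 := (Functor.const _).obj D0.real,
      monoid := (zeroMonoid (Fin 3) : (Fin 3)ᵒᵖ ⥤ CommMonCat.{0}),
      str := G ⋙ ElemFrobenioid.zeroSection _,
      monoid0 := (zeroMonoid D0 : D0ᵒᵖ ⥤ CommMonCat.{0}),
      str0 := (Functor.const (Fin 2)).obj D0.real ⋙ ElemFrobenioid.zeroSection _,
      region := fun _ => AngularRegion.isotropicOfTip 1 }
  let f : (0 : Fin 2) ⟶ 1 := homOfLE (by decide)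
  let βD : G.obj 0 ⟶ (1 : Fin 3) := homOfLE (by decide)
  let αD : (1 : Fin 3) ⟶ G.obj 1 := homOfLE (by decide)
  obtain ⟨E', -, -, i, -⟩ := h (Fin 3) πb T f 1 βD αD (Subsingleton.elim _ _)
  have hE' : G.obj E' = 1 := le_antisymm (leOfHom i.hom) (leOfHom i.inv)
  change (if E' = 0 then (0 : Fin 3) else 2) = 1 at hE'
  by_cases h0 : E' = 0
  · rw [if_pos h0] at hE'
    exact absurd hE' (by decide)
  · rw [if_neg h0] at hE'
    exact absurd hE' (by decide)

/-- **`Tower.PropVII` is not a property of every tower** (universal closure of FACT-LIST row F-0821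
REFUTED at object universe `0`): the tower `F =` (nonempty subsets of `{ff, tt}`) `→ D = Fin 2`
(`s ↦ 1` iff `tt ∈ s`), `F → F₀ = Fin 2` CONSTANT, over the constant base `Spec ℝ`: the arrow
`{ff} ⊆ {ff, tt}` projects to an identity of `F₀` (a pull-back morphism) and to the FSM-morphism `0 → 1`
of `D`, but is not fiberwise-surjective in `F`, hence not an FSM-morphism. The instance forms at the
named towers `A, N, R` hold over every base (`A.propVII`, `N.propVII`, `R.propVII`, `prop34_vii_holds`).
[cite: MochizukiFrdII2008, Prop 3.4 (vii) p.30] -/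
theorem Tower.not_forall_propVII :
    ¬ ∀ (D : Type) [Category.{0} D] (π : D ⥤ D0) (T : Tower π), T.PropVII := by
  intro h
  let πb : Fin 2 ⥤ D0 := (Functor.const _).obj D0.real
  let G : {s : Finset Bool // s.Nonempty} ⥤ Fin 2 := monotone_memTrue.functor
  let T : Tower πb :=
    { F := {s : Finset Bool // s.Nonempty}, F0 := Fin 2, toD := G,
      toF0 := (Functor.const _).obj (0 : Fin 2), base0 := (Functor.const _).obj D0.real,
      monoid := (zeroMonoid (Fin 2) : (Fin 2)ᵒᵖ ⥤ CommMonCat.{0}),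
      str := G ⋙ ElemFrobenioid.zeroSection _,
      monoid0 := (zeroMonoid D0 : D0ᵒᵖ ⥤ CommMonCat.{0}),
      str0 := (Functor.const (Fin 2)).obj D0.real ⋙ ElemFrobenioid.zeroSection _,
      region := fun _ => AngularRegion.isotropicOfTip 1 }
  let φ : (⟨{false}, Finset.singleton_nonempty _⟩ : {s : Finset Bool // s.Nonempty}) ⟶
      ⟨Finset.univ, Finset.univ_nonempty⟩ := homOfLE (Finset.subset_univ _)
  have hpb : PreFrobenioid.IsPullbackMorphism T.str0 (T.toF0.map φ) := isPullbackMorphism_id T.str0 _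
  exact not_isFiberwiseSurjective_sets φ ((h (Fin 2) πb T φ hpb).1 (isFSM_fin2 (G.map φ))).1

end MoreSchemata

end ArchFrd

end

end Literature.AlgebraicGeometry.Frobenioids
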